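import Summits.AnomalousDissipation.AnomalousDissipation.Theorems.TaylorCertificatesKolmogorovFloorResponseDefs
import Literature.Analysis.FunctionSpaces.TorusFourierModes
import Literature.Analysis.FluidPDE.NSGalerkinFourier

/-!
# Beat-dual pairing bounds (DICTIONARY of line `Sketch`, crux KolmogorovFloor; conjuncts (D3), (D4))

Two Fourier-side duality bounds for pairings `∫ ⟪r, W⟫` against a smooth solenoidal mean-zero
multiplier `W` band-limited at level `N` with slope `|κ| ‖Ŵ(κ)‖ ≤ M`:

* `abs_integral_inner_le_slope_sum` (D3): `|∫⟪r, W⟫| ≤ M Σ_{0 ≠ κ ∈ ball N} ‖r̂(κ) − q(κ) κ‖ / |κ|`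
  for every smooth `r` and every scalar family `q` (gradients are invisible: `κ · Ŵ(κ) = 0`);
* `abs_integral_inner_convect_realTrigPoly_le` (D4): for a real trigonometric polynomial
  `b = realTrigPoly S C` with conjugate-symmetric transversal coefficients,
  `|∫⟪(b·∇)b, W⟫| ≤ 2π M (Σ_{κ∈S} ‖C κ‖)²` (the convection symbol, with `C(l)·m = C(l)·κ`).
-/

noncomputable section

set_option linter.dupNamespace false

open MeasureTheory Matrix Finset UnitAddTorus
open scoped BigOperators ComplexConjugate InnerProductSpace

namespace Summit.AnomalousDissipation.AnomalousDissipation.Theorems.KolmogorovFloor.Response.Dictionary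

open Literature.Analysis.FunctionSpaces Literature.Analysis.FluidPDE

/-! ### Small Fourier-side tools -/

/-- The zero mode of a mean-zero field vanishes: `Ŵ(0) = complexify (∫ W) = 0`. -/
theorem fc_zero_of_hasZeroMean {W : UnitAddTorus (Fin 3) → EuclideanSpace ℝ (Fin 3)} (h0 : Torus.HasZeroMean W) :
    mFourierCoeff (EuclideanSpace.complexify ∘ W) 0 = 0 := by
  rw [Torus.mFourierCoeff_eq_integral_volume]
  simp only [neg_zero, mFourier_zero, ContinuousMap.one_apply, one_smul, Function.comp_apply]
  rw [EuclideanSpace.complexify.integral_comp_comm W, show (∫ x, W x) = 0 from h0, map_zero]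

/-- Gradients are invisible to solenoidal multipliers on the Fourier side: `⟪q κ, Ŵ(κ)⟫ = 0`. -/
theorem inner_smul_freqVec_fc_eq_zero {W : UnitAddTorus (Fin 3) → EuclideanSpace ℝ (Fin 3)} (hW : Torus.IsSmooth W)
    (hdiv : Torus.IsDivFree W) (q : ℂ) (κ : Fin 3 → ℤ) :
    ⟪q • Torus.freqVec κ, mFourierCoeff (EuclideanSpace.complexify ∘ W) κ⟫_ℂ = 0 := by
  rw [inner_smul_left, Torus.inner_freqVec_left, hdiv.sum_mul_mFourierCoeff_eq_zero hW κ, mul_zero]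

/-- `|κ|² > 0` for `κ ≠ 0`, in the form `0 < √(freqNormSq κ)`. -/
theorem sqrt_freqNormSq_pos {κ : Fin 3 → ℤ} (hκ : κ ≠ 0) : 0 < Real.sqrt (Torus.freqNormSq κ) :=
  Real.sqrt_pos.2 (lt_of_le_of_ne (Torus.freqNormSq_nonneg κ)
    fun h => hκ ((Torus.freqNormSq_eq_zero_iff κ).1 h.symm))

/-- Slope control of a single coefficient: `‖Ŵ(κ)‖ ≤ M / |κ|` for `κ ≠ 0`. -/
theorem norm_fc_le_slope_div {W : UnitAddTorus (Fin 3) → EuclideanSpace ℝ (Fin 3)} {M : ℝ}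
    (hM : ∀ κ, Real.sqrt (Torus.freqNormSq κ) * ‖mFourierCoeff (EuclideanSpace.complexify ∘ W) κ‖ ≤ M)
    {κ : Fin 3 → ℤ} (hκ : κ ≠ 0) :
    ‖mFourierCoeff (EuclideanSpace.complexify ∘ W) κ‖ ≤ M / Real.sqrt (Torus.freqNormSq κ) := by
  rw [le_div_iff₀ (sqrt_freqNormSq_pos hκ), mul_comm]
  exact hM κ

/-- `|Re ⟪a, b⟫| ≤ ‖a‖ ‖b‖` in `ℂ³`. -/
theorem abs_re_inner_le (a b : EuclideanSpace ℂ (Fin 3)) : |(⟪a, b⟫_ℂ).re| ≤ ‖a‖ * ‖b‖ :=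
  (Complex.abs_re_le_norm _).trans (norm_inner_le_norm a b)

/-! ### (D3) The beat-dual pairing bound -/

/-- **(D3) Beat-dual pairing.** For smooth `r`, a smooth solenoidal mean-zero `W` band-limited at
level `N` with slope `|κ| ‖Ŵ(κ)‖ ≤ M`, and ANY scalar family `q` (gradient parts are invisible),
`|∫ ⟪r, W⟫| ≤ M · Σ_{0 ≠ κ ∈ ball N} ‖r̂(κ) − q(κ) κ‖ / |κ|`. -/
theorem abs_integral_inner_le_slope_sum (r W : UnitAddTorus (Fin 3) → EuclideanSpace ℝ (Fin 3)) (N : ℕ) (M : ℝ)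
    (q : (Fin 3 → ℤ) → ℂ)
    (hr : Torus.IsSmooth r) (hW : Torus.IsSmooth W) (hdiv : Torus.IsDivFree W)
    (h0 : Torus.HasZeroMean W)
    (hband : ∀ κ, (N : ℝ) ^ 2 < Torus.freqNormSq κ → mFourierCoeff (EuclideanSpace.complexify ∘ W) κ = 0)
    (hM : ∀ κ, Real.sqrt (Torus.freqNormSq κ) * ‖mFourierCoeff (EuclideanSpace.complexify ∘ W) κ‖ ≤ M) :
    |∫ x, ⟪r x, W x⟫_ℝ| ≤ M * ∑ κ ∈ (Torus.freqBall N).erase 0,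
      ‖mFourierCoeff (EuclideanSpace.complexify ∘ r) κ - q κ • Torus.freqVec κ‖ /
        Real.sqrt (Torus.freqNormSq κ) := by
  rw [Torus.integral_inner_eq_sum_freqBall (hr.memLp 2) (hW.memLp 2) hband]
  rw [← Finset.sum_erase (Torus.freqBall N) (a := (0 : Fin 3 → ℤ))
    (by rw [fc_zero_of_hasZeroMean h0, inner_zero_right, Complex.zero_re])]
  have hterm : ∀ κ ∈ (Torus.freqBall N).erase 0,
      (⟪mFourierCoeff (EuclideanSpace.complexify ∘ r) κ,
          mFourierCoeff (EuclideanSpace.complexify ∘ W) κ⟫_ℂ).re =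
        (⟪mFourierCoeff (EuclideanSpace.complexify ∘ r) κ - q κ • Torus.freqVec κ,
          mFourierCoeff (EuclideanSpace.complexify ∘ W) κ⟫_ℂ).re := by
    intro κ _
    rw [inner_sub_left, inner_smul_freqVec_fc_eq_zero hW hdiv, sub_zero]
  rw [Finset.sum_congr rfl hterm, Finset.mul_sum]
  refine (Finset.abs_sum_le_sum_abs _ _).trans (Finset.sum_le_sum fun κ hκ => ?_)
  have hκ0 : κ ≠ 0 := (Finset.mem_erase.1 hκ).1
  calc |(⟪mFourierCoeff (EuclideanSpace.complexify ∘ r) κ - q κ • Torus.freqVec κ,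
          mFourierCoeff (EuclideanSpace.complexify ∘ W) κ⟫_ℂ).re|
      ≤ ‖mFourierCoeff (EuclideanSpace.complexify ∘ r) κ - q κ • Torus.freqVec κ‖ *
          ‖mFourierCoeff (EuclideanSpace.complexify ∘ W) κ‖ := abs_re_inner_le _ _
    _ ≤ ‖mFourierCoeff (EuclideanSpace.complexify ∘ r) κ - q κ • Torus.freqVec κ‖ *
          (M / Real.sqrt (Torus.freqNormSq κ)) :=
        mul_le_mul_of_nonneg_left (norm_fc_le_slope_div hM hκ0) (norm_nonneg _)
    _ = M * (‖mFourierCoeff (EuclideanSpace.complexify ∘ r) κ - q κ • Torus.freqVec κ‖ /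
          Real.sqrt (Torus.freqNormSq κ)) := by ring

/-! ### (D4) Self-advection of a solenoidal trigonometric polynomial -/

/-- `‖κ‖_{ℂ³} = |κ|`: the norm of the frequency vector is `√(freqNormSq κ)`. -/
theorem norm_freqVec (κ : Fin 3 → ℤ) : ‖Torus.freqVec κ‖ = Real.sqrt (Torus.freqNormSq κ) := by
  rw [EuclideanSpace.norm_eq, Torus.freqNormSq]
  congr 1
  refine Finset.sum_congr rfl fun i _ => ?_
  rw [Torus.freqVec_apply, Complex.norm_intCast, sq_abs]

/-- `|κ · v| ≤ |κ| ‖v‖` (Cauchy–Schwarz against the frequency vector). -/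
theorem norm_sum_mul_le (κ : Fin 3 → ℤ) (v : EuclideanSpace ℂ (Fin 3)) :
    ‖∑ j, (κ j : ℂ) * v j‖ ≤ Real.sqrt (Torus.freqNormSq κ) * ‖v‖ := by
  rw [← Torus.inner_freqVec_left, ← norm_freqVec]
  exact norm_inner_le_norm _ _

/-- Symbol of a transversal mode: if `l · C(l) = 0` and `l + m = κ` then `C(l) · m = κ · C(l)`. -/
theorem sum_mul_eq_of_transversal {C : (Fin 3 → ℤ) → EuclideanSpace ℂ (Fin 3)} {l m κ : Fin 3 → ℤ}
    (hT : ∑ j, (l j : ℂ) * C l j = 0) (hlm : l + m = κ) :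
    ∑ j, C l j * (m j : ℂ) = ∑ j, (κ j : ℂ) * C l j := by
  have hm : ∀ j, (m j : ℂ) = (κ j : ℂ) - (l j : ℂ) := fun j => by
    rw [← hlm, Pi.add_apply, Int.cast_add]; ring
  simp_rw [hm, mul_sub, Finset.sum_sub_distrib]
  rw [show ∑ j, C l j * (l j : ℂ) = ∑ j, (l j : ℂ) * C l j from
    Finset.sum_congr rfl fun j _ => mul_comm _ _, hT, sub_zero]
  exact Finset.sum_congr rfl fun j _ => mul_comm _ _

/-- Termwise bound of the self-advection symbol of a transversal family:
`‖convectionCoeff S C C κ‖ ≤ 2π |κ| Σ_{l,m∈S, l+m=κ} ‖C l‖ ‖C m‖`. -/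
theorem norm_convectionCoeff_le_of_transversal (S : Finset (Fin 3 → ℤ))
    {C : (Fin 3 → ℤ) → EuclideanSpace ℂ (Fin 3)} (hT : ∀ κ ∈ S, ∑ i, (κ i : ℂ) * C κ i = 0)
    (κ : Fin 3 → ℤ) :
    ‖Torus.convectionCoeff S C C κ‖ ≤ 2 * Real.pi * Real.sqrt (Torus.freqNormSq κ) *
      ∑ l ∈ S, ∑ m ∈ S, (if l + m = κ then ‖C l‖ * ‖C m‖ else 0) := by
  rw [Torus.convectionCoeff_def, Finset.mul_sum]
  refine (norm_sum_le _ _).trans (Finset.sum_le_sum fun l hl => ?_)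
  rw [Finset.mul_sum]
  refine (norm_sum_le _ _).trans (Finset.sum_le_sum fun m _ => ?_)
  split_ifs with hlm
  · rw [norm_smul, sum_mul_eq_of_transversal (hT l hl) hlm]
    have h2π : ‖2 * (Real.pi : ℂ) * Complex.I * ∑ j, (κ j : ℂ) * C l j‖ =
        2 * Real.pi * ‖∑ j, (κ j : ℂ) * C l j‖ := by
      simp only [norm_mul, Complex.norm_ofNat, Complex.norm_real, Real.norm_eq_abs,
        abs_of_pos Real.pi_pos, Complex.norm_I, mul_one]
    rw [h2π]
    have h := norm_sum_mul_le κ (C l)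
    calc 2 * Real.pi * ‖∑ j, (κ j : ℂ) * C l j‖ * ‖C m‖
        ≤ 2 * Real.pi * (Real.sqrt (Torus.freqNormSq κ) * ‖C l‖) * ‖C m‖ := by gcongr
      _ = _ := by ring
  · rw [norm_zero, mul_zero]

/-- **(D4) Self-advection bound.** For a real trigonometric polynomial `b = realTrigPoly S C` on a
symmetric `S` with conjugate-symmetric transversal coefficients, and a smooth solenoidal mean-zero
`W` band-limited at level `N` with slope `|κ| ‖Ŵ(κ)‖ ≤ M` (`M ≥ 0`):
`|∫ ⟪(b·∇)b, W⟫| ≤ 2π M (Σ_{κ∈S} ‖C κ‖)²`. -/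
theorem abs_integral_inner_convect_realTrigPoly_le (S : Finset (Fin 3 → ℤ))
    (C : (Fin 3 → ℤ) → EuclideanSpace ℂ (Fin 3)) (W : UnitAddTorus (Fin 3) → EuclideanSpace ℝ (Fin 3))
    (N : ℕ) (M : ℝ)
    (hS : ∀ κ ∈ S, -κ ∈ S) (hC : Torus.IsConjSymm C) (hT : ∀ κ ∈ S, ∑ i, (κ i : ℂ) * C κ i = 0)
    (hM0 : 0 ≤ M) (hW : Torus.IsSmooth W) (hdiv : Torus.IsDivFree W) (h0 : Torus.HasZeroMean W)
    (hband : ∀ κ, (N : ℝ) ^ 2 < Torus.freqNormSq κ → mFourierCoeff (EuclideanSpace.complexify ∘ W) κ = 0)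
    (hM : ∀ κ, Real.sqrt (Torus.freqNormSq κ) * ‖mFourierCoeff (EuclideanSpace.complexify ∘ W) κ‖ ≤ M) :
    |∫ x, ⟪Torus.convect (Torus.realTrigPoly S C) (Torus.realTrigPoly S C) x, W x⟫_ℝ| ≤
      2 * Real.pi * M * (∑ κ ∈ S, ‖C κ‖) ^ 2 := by
  have hbs : Torus.IsSmooth (Torus.realTrigPoly S C) := Torus.isSmooth_realTrigPoly S C
  have h3 := abs_integral_inner_le_slope_sum (Torus.convect (Torus.realTrigPoly S C)
    (Torus.realTrigPoly S C)) W N M (fun _ => 0) (hbs.convect hbs) hW hdiv h0 hband hM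
  refine h3.trans ?_
  simp only [zero_smul, sub_zero]
  have hF : ∀ κ, mFourierCoeff (EuclideanSpace.complexify ∘
      Torus.convect (Torus.realTrigPoly S C) (Torus.realTrigPoly S C)) κ = Torus.convectionCoeff S C C κ :=
    fun κ => Torus.mFourierCoeff_convect_realTrigPoly hS hC hC κ
  simp_rw [hF]
  have hterm : ∀ κ ∈ (Torus.freqBall N).erase 0,
      ‖Torus.convectionCoeff S C C κ‖ / Real.sqrt (Torus.freqNormSq κ) ≤
        2 * Real.pi * ∑ l ∈ S, ∑ m ∈ S, (if l + m = κ then ‖C l‖ * ‖C m‖ else 0) := by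
    intro κ hκ
    have hκ0 : κ ≠ 0 := (Finset.mem_erase.1 hκ).1
    rw [div_le_iff₀ (sqrt_freqNormSq_pos hκ0)]
    calc ‖Torus.convectionCoeff S C C κ‖
        ≤ 2 * Real.pi * Real.sqrt (Torus.freqNormSq κ) *
            ∑ l ∈ S, ∑ m ∈ S, (if l + m = κ then ‖C l‖ * ‖C m‖ else 0) :=
          norm_convectionCoeff_le_of_transversal S hT κ
      _ = _ := by ring
  have hcomb : ∑ κ ∈ (Torus.freqBall N).erase 0, ∑ l ∈ S, ∑ m ∈ S,
      (if l + m = κ then ‖C l‖ * ‖C m‖ else 0) ≤ ∑ l ∈ S, ∑ m ∈ S, ‖C l‖ * ‖C m‖ := by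
    rw [Finset.sum_comm]
    refine Finset.sum_le_sum fun l _ => ?_
    rw [Finset.sum_comm]
    refine Finset.sum_le_sum fun m _ => ?_
    rw [Finset.sum_ite_eq]
    split_ifs
    · exact le_rfl
    · positivity
  calc M * ∑ κ ∈ (Torus.freqBall N).erase 0,
        ‖Torus.convectionCoeff S C C κ‖ / Real.sqrt (Torus.freqNormSq κ)
      ≤ M * ∑ κ ∈ (Torus.freqBall N).erase 0,
          (2 * Real.pi * ∑ l ∈ S, ∑ m ∈ S, (if l + m = κ then ‖C l‖ * ‖C m‖ else 0)) :=
        mul_le_mul_of_nonneg_left (Finset.sum_le_sum hterm) hM0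
    _ = 2 * Real.pi * M * ∑ κ ∈ (Torus.freqBall N).erase 0, ∑ l ∈ S, ∑ m ∈ S,
          (if l + m = κ then ‖C l‖ * ‖C m‖ else 0) := by
        rw [← Finset.mul_sum]; ring
    _ ≤ 2 * Real.pi * M * ∑ l ∈ S, ∑ m ∈ S, ‖C l‖ * ‖C m‖ :=
        mul_le_mul_of_nonneg_left hcomb (by positivity)
    _ = 2 * Real.pi * M * (∑ κ ∈ S, ‖C κ‖) ^ 2 := by rw [sq, Finset.sum_mul_sum]

end Summit.AnomalousDissipation.AnomalousDissipation.Theorems.KolmogorovFloor.Response.Dictionary
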